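import Summits.Ventures.CertifiedManyBodySolver.Downfold.RouterWordScoreV8PreregG17

/-!
# Router-word score — gating ONE SITE of a multi-site word: when does it create a NEW DISAGREE?

[Provenance: hubbard-downfold-lead g23 rulings R-ry / R-sa (2026-08-29T05:54Z / 06:05Z, director-hubbard «locate»: RISK-ARM
CONTROLS for the ROUTER v0.7 «D3-occ» probation); hubbard-downfold-score-2 g17 STATUS 05:59Z (two-d-site rows) and its CORRECTION
06:1xZ after R-sa (c); hubbard-downfold-cur-1 g38 LOCATE PASS 1–2 (CaCu₃Ru₄O₁₂ V8-256, Cu-only 3D cuprates).] [folklore] bookkeeping of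
ACCEPTANCE §4.2's score (`RouterWordScore`); no physics.

The router prints a MULTI-SITE word as site groups, `…@Cu; …@Ru`, and the score reads the concatenated token list whose head is the
FIRST group's head (R6 form; M424 «UND:MIXED+EPH@Zr; UND:MIXED+EPH@Ru»). An exclusion gate (A11 D3-occ, the proposed A12) acts PER
SITE: it replaces the gated site's group by «EPH». `RouterWordScoreV8PreregG17` treated one-site rows; this file settles the
multi-site question the risk-arm commission raised (CaCu₃Ru₄O₁₂: Cu²⁺ A′ site + Ru-4d B site): gating the LEADING group `g₁` of a
print `g₁ ++ g₂` creates a NEW DISAGREE (v0.6.5 cell AGREE/PARTIAL, gated cell DISAGREE — the KILL statistic's unit) IF AND ONLY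
IF some typed alternative's primary occurs in the full print AND no typed alternative's primary occurs in `eph :: g₂` — i.e. iff
EVERY emitted typed primary sat in the gated group and «EPH» is nobody's primary (`siteGate_newDisagree_iff`). Corollaries: if the
UNGATED groups emit some typed primary, no gate on the leading site can bite (`siteGate_inert_of_emitted_elsewhere` — the Ru-4d
straddle «UND:MIXED+EPH@Ru» under a «UND:MIXED+EPH» typing); if nothing typed is emitted at all the row is DISAGREE under both
routers, not NEW (`siteGate_inert_of_nothing_emitted` — the straddle ×2 print under a «UND:MULTIORB…» or «UND:HF» typing); and the
one biting path of R-sa (c) — a «UND:MULTIORB…» head printed AT the gated Cu site with only a straddle at Ru — is an instance of the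
«only if» direction turned around (`cacu3ru4o12_paths`). For a ONE-d-species material `g₂` carries no d head and the criterion
reduces to G17's `dheadRow_kill_shape`.
-/

namespace Summit.Ventures.CertifiedManyBodySolver.Downfold

namespace RouterScore

section general

variable {α : Type*} [DecidableEq α] (structural : α → Bool)

/-- With an expectation registered and the structure gate closed, an emitted typed primary rules out `DISAGREE` (the clause
chain stops at `AGREE` or `PARTIAL`). [folklore] -/
theorem outcome_ne_disagree_of_primary_emitted {p : α} {tl : List α} {alts : List (List α)} (halts : alts ≠ [])
    (hgate : (structural p && !expectsStructural structural alts) = false)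
    (h : ∃ a ∈ alts, primaryEmitted (p :: tl) a = true) : outcome structural (p :: tl) alts ≠ .DISAGREE := by
  rw [outcome_cons, if_neg halts, if_neg (by simp [hgate])]
  have hq : alts.any (primaryEmitted (p :: tl)) = true := List.any_eq_true.2 h
  by_cases hm : alts.any (fullMatch (p :: tl)) = true
  · rw [if_pos hm]; decide
  · rw [if_neg hm, if_pos hq]; decide

/-- … and characterises it: `DISAGREE` iff no typed alternative's primary is emitted. [folklore] -/
theorem outcome_eq_disagree_iff {p : α} {tl : List α} {alts : List (List α)} (halts : alts ≠ [])
    (hgate : (structural p && !expectsStructural structural alts) = false) :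
    outcome structural (p :: tl) alts = .DISAGREE ↔ ∀ a ∈ alts, primaryEmitted (p :: tl) a = false := by
  constructor
  · intro h a ha
    by_contra hpa
    exact outcome_ne_disagree_of_primary_emitted structural halts hgate ⟨a, ha, by simpa using hpa⟩ h
  · exact outcome_eq_disagree_of_no_primary_emitted structural halts hgate

/-- Trichotomy behind the KILL unit: with the gates closed the cell is `AGREE`, `PARTIAL` or `DISAGREE`. [folklore] -/
theorem outcome_trichotomy {p : α} {tl : List α} {alts : List (List α)} (halts : alts ≠ [])
    (hgate : (structural p && !expectsStructural structural alts) = false) :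
    outcome structural (p :: tl) alts = .AGREE ∨ outcome structural (p :: tl) alts = .PARTIAL
      ∨ outcome structural (p :: tl) alts = .DISAGREE := by
  rw [outcome_cons, if_neg halts, if_neg (by simp [hgate])]
  by_cases hm : alts.any (fullMatch (p :: tl)) = true
  · rw [if_pos hm]; exact Or.inl rfl
  · rw [if_neg hm]
    by_cases hq : alts.any (primaryEmitted (p :: tl)) = true
    · rw [if_pos hq]; exact Or.inr (Or.inl rfl)
    · rw [if_neg hq]; exact Or.inr (Or.inr rfl)

end general

open Head

/-- `newDisagreeOf` unfolded: the gated cell is `DISAGREE` and the un-gated cell was `AGREE` or `PARTIAL`. [folklore] -/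
theorem newDisagreeOf_eq_true_iff (o065 o070 : Outcome) :
    newDisagreeOf o065 o070 = true ↔ o070 = .DISAGREE ∧ (o065 = .AGREE ∨ o065 = .PARTIAL) := by
  unfold newDisagreeOf
  cases o065 <;> cases o070 <;> simp

/-- THE SITE-GATE CRITERION. A print led by the group `p₁ :: t₁` (the site to be gated, `p₁` non-structural) followed by the other
sites' tokens `g₂`, scored against a nonempty typing: replacing the leading group by «EPH» yields
a NEW DISAGREE iff some typed primary is emitted by the full print and none by `eph :: g₂`. [folklore] -/
theorem siteGate_newDisagree_iff (p₁ : Head) (t₁ g₂ : List Head) (alts : List (List Head)) (halts : alts ≠ [])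
    (hp₁ : Head.structural p₁ = false) :
    newDisagreeOf (score (p₁ :: (t₁ ++ g₂)) alts) (score (eph :: g₂) alts) = true
      ↔ (∃ a ∈ alts, primaryEmitted (p₁ :: (t₁ ++ g₂)) a = true) ∧ (∀ a ∈ alts, primaryEmitted (eph :: g₂) a = false) := by
  have hg₁ : (Head.structural p₁ && !expectsStructural Head.structural alts) = false := by simp [hp₁]
  have hgE : (Head.structural eph && !expectsStructural Head.structural alts) = false := by simp [Head.structural]
  rw [newDisagreeOf_eq_true_iff, score, score, outcome_eq_disagree_iff Head.structural halts hgE]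
  constructor
  · rintro ⟨h70, h65⟩
    refine ⟨?_, h70⟩
    have hne : outcome Head.structural (p₁ :: (t₁ ++ g₂)) alts ≠ .DISAGREE := by
      rcases h65 with h | h <;> rw [h] <;> decide
    exact primary_emitted_of_not_disagree Head.structural halts hg₁ hne
  · rintro ⟨h65, h70⟩
    refine ⟨h70, ?_⟩
    have hne := outcome_ne_disagree_of_primary_emitted Head.structural halts hg₁ h65
    rcases outcome_trichotomy Head.structural halts hg₁ with h | h | h
    · exact Or.inl h
    · exact Or.inr h
    · exact absurd h hne

/-- COROLLARY 1 — «THE SECOND SITE RESCUES»: if some typed alternative's primary already occurs among the UNGATED tokens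
`eph :: g₂` (e.g. the Ru-4d straddle «UND:MIXED+EPH@Ru» under a typing that lists «UND:MIXED+EPH», or any typing listing bare «EPH»),
gating the leading site never creates a new DISAGREE — whatever the leading group printed. [folklore] -/
theorem siteGate_inert_of_emitted_elsewhere (p₁ : Head) (t₁ g₂ : List Head) (alts : List (List Head)) (halts : alts ≠ [])
    (hp₁ : Head.structural p₁ = false)
    (h : ∃ a ∈ alts, primaryEmitted (eph :: g₂) a = true) :
    newDisagreeOf (score (p₁ :: (t₁ ++ g₂)) alts) (score (eph :: g₂) alts) = false := by
  by_contra hc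
  have ht : newDisagreeOf (score (p₁ :: (t₁ ++ g₂)) alts) (score (eph :: g₂) alts) = true := by simpa using hc
  obtain ⟨a, ha, hpa⟩ := h
  have := ((siteGate_newDisagree_iff p₁ t₁ g₂ alts halts hp₁).1 ht).2 a ha
  rw [this] at hpa; exact Bool.false_ne_true hpa

/-- COROLLARY 2 — «NOTHING TYPED IS PRINTED ANYWHERE»: if no typed primary occurs in the full print (straddle ×2 under a
«UND:MULTIORB…» or «UND:HF» typing), the row is DISAGREE under BOTH routers and the gate creates nothing NEW. [folklore] -/
theorem siteGate_inert_of_nothing_emitted (p₁ : Head) (t₁ g₂ : List Head) (alts : List (List Head)) (halts : alts ≠ [])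
    (hp₁ : Head.structural p₁ = false)
    (h : ∀ a ∈ alts, primaryEmitted (p₁ :: (t₁ ++ g₂)) a = false) :
    score (p₁ :: (t₁ ++ g₂)) alts = .DISAGREE
      ∧ newDisagreeOf (score (p₁ :: (t₁ ++ g₂)) alts) (score (eph :: g₂) alts) = false := by
  have hg₁ : (Head.structural p₁ && !expectsStructural Head.structural alts) = false := by simp [hp₁]
  refine ⟨outcome_eq_disagree_of_no_primary_emitted Head.structural halts hg₁ h, ?_⟩
  by_contra hc
  have ht : newDisagreeOf (score (p₁ :: (t₁ ++ g₂)) alts) (score (eph :: g₂) alts) = true := by simpa using hc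
  obtain ⟨⟨a, ha, hpa⟩, -⟩ := (siteGate_newDisagree_iff p₁ t₁ g₂ alts halts hp₁).1 ht
  rw [h a ha] at hpa; exact Bool.false_ne_true hpa

/-! ## The risk-arm control no. 1 (CaCu₃Ru₄O₁₂, V8-256) and the Cu-only shape, by `decide` -/

/-- The Ru-4d group as every Ru/Rh/Ir record of ours printed it: the R3c straddle «UND:MIXED(…)+EPH». [folklore] -/
def ruStraddle : List Head := [undMixed, eph]

/-- CaCu₃Ru₄O₁₂ typed «UND:MULTIORB | UND:MULTIORB+EPH» (lead R-sa (b), AS DRAFTED). The three Cu-group prints and their gated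
twins: (i) Cu straddle «UND:MIXED+EPH@Cu; UND:MIXED+EPH@Ru» ⇒ DISAGREE under both routers — NOT new (the expected print: m(Cu) = 0
on every Cu record); (ii) a MULTIORB-class head AT Cu leading (kept PBE Cu moment ≥ θ_m, or a Cu k-head) «UND:MULTIORB(…)+EPH@Cu;
UND:MIXED+EPH@Ru» ⇒ AGREE, gated «EPH@Cu; UND:MIXED+EPH@Ru» ⇒ DISAGREE ⇒ NEW — the ONE biting path (lead R-sa (c)); (iii) under the
softer «UND:MIXED+EPH» typing the same gate is inert (AGREE → PARTIAL, the Ru group rescues). [folklore] -/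
theorem cacu3ru4o12_paths :
    let multiorbTyped : List (List Head) := [[undMultiorb], [undMultiorb, eph]]
    -- (i) straddle at Cu, straddle at Ru: DISAGREE / DISAGREE, not new
    score ([undMixed, eph] ++ ruStraddle) multiorbTyped = .DISAGREE
    ∧ score (eph :: ruStraddle) multiorbTyped = .DISAGREE
    ∧ newDisagreeOf (score ([undMixed, eph] ++ ruStraddle) multiorbTyped) (score (eph :: ruStraddle) multiorbTyped) = false
    -- (ii) MULTIORB head at Cu leading: AGREE → DISAGREE, NEW
    ∧ score ([undMultiorb, eph] ++ ruStraddle) multiorbTyped = .AGREE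
    ∧ newDisagreeOf (score ([undMultiorb, eph] ++ ruStraddle) multiorbTyped) (score (eph :: ruStraddle) multiorbTyped) = true
    -- (iii) «UND:MIXED+EPH» typing: AGREE → PARTIAL, inert
    ∧ score ([undMixed, eph] ++ ruStraddle) [[undMixed, eph]] = .AGREE
    ∧ score (eph :: ruStraddle) [[undMixed, eph]] = .PARTIAL
    ∧ newDisagreeOf (score ([undMixed, eph] ++ ruStraddle) [[undMixed, eph]]) (score (eph :: ruStraddle) [[undMixed, eph]]) = false := by
  decide

/-- Under the «UND:MIXED+EPH» typing the Ru straddle rescues WHATEVER the Cu group prints (Corollary 1 instantiated: the Ru group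
emits the typed primary «UND:MIXED»). [folklore] -/
theorem cacu3ru4o12_mixedTyped_inert (p₁ : Head) (t₁ : List Head) (hp₁ : Head.structural p₁ = false) :
    newDisagreeOf (score (p₁ :: (t₁ ++ ruStraddle)) [[undMixed, eph]]) (score (eph :: ruStraddle) [[undMixed, eph]]) = false :=
  siteGate_inert_of_emitted_elsewhere p₁ t₁ ruStraddle [[undMixed, eph]] (by decide) hp₁
    ⟨[undMixed, eph], by simp, by decide⟩

/-- THE Cu-ONLY SHAPE (La₄BaCu₅O₁₃ / LaCuO₃-class, one d species ⇒ `g₂ = []`): typed with the straddle head and no bare «EPH»,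
the clause-silent straddle print is AGREE and the gated print «EPH» is DISAGREE ⇒ NEW — the biting row of R-sa (a)/(d); typed with
bare «EPH» beside, inert (G17 §2). [folklore] -/
theorem cuOnly_shape :
    newDisagreeOf (score [undMixed, eph] [[undMixed, eph], [undMixed]]) (score [eph] [[undMixed, eph], [undMixed]]) = true
    ∧ newDisagreeOf (score [undMixed, eph] [[undMixed, eph], [eph]]) (score [eph] [[undMixed, eph], [eph]]) = false := by
  decide

/-! ## §2 (appended 2026-08-29T08:3xZ) The A12 KILL UNIT «WRONG FIRE» = LOSS, and the AV₃Sb₅ pilot rows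

director-hubbard g18's C-MO letter (cell INBOX 2026-08-29T07:59:09Z) and lead g24's C-MO ADDENDUM 3 (STATUS 08:21:00Z, the SI-6′
pre-registration) amend the A12 kill unit after score-2's Q-sv-1 answer: a WRONG FIRE is an A12 fire on a POWERED control (no bare
«EPH» typed) whose word of record is AGREE and whose re-word scores non-AGREE — i.e. a LOSS in the sense of `branchOf`, not only a
new DISAGREE. This section records that the new-DISAGREE unit of the A11 rule is the special case (`loss_of_newDisagree`), and that
the three AV₃Sb₅ rows of pilot leg (ii) — typed «EPH+UND:STRUCT | UND:MIXED+EPH», word of record «UND:MIXED+EPH» (AGREE), fired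
re-word «EPH(spin-inert: …)» with no rider — are LOSS (AGREE → PARTIAL) but NOT new-DISAGREE: KILL-capable under the amended unit
only (`av3sb5_fire`). -/

/-- The amended A12 kill unit: a wrong fire = the un-gated cell AGREE and the fired cell not AGREE. [folklore] -/
def wrongFireOf (o065 o070 : Outcome) : Bool := decide (o065 = .AGREE) && !decide (o070 = .AGREE)

/-- A new DISAGREE is always a LOSS; the converse fails (AGREE → PARTIAL). [folklore] -/
theorem loss_of_newDisagree (o065 o070 : Outcome) (h : newDisagreeOf o065 o070 = true) : branchOf o065 o070 = .LOSS := by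
  revert h; unfold newDisagreeOf branchOf rank; cases o065 <;> cases o070 <;> decide

/-- A wrong fire is always a LOSS, and a LOSS from AGREE is a wrong fire. [folklore] -/
theorem wrongFire_iff_loss_from_agree (o065 o070 : Outcome) :
    wrongFireOf o065 o070 = true ↔ (o065 = .AGREE ∧ branchOf o065 o070 = .LOSS) := by
  unfold wrongFireOf branchOf rank; cases o065 <;> cases o070 <;> decide

/-- THE AV₃Sb₅ PILOT ROWS (M346 CsV₃Sb₅ / M347 KV₃Sb₅ / M348 RbV₃Sb₅, SI-6′ leg (ii)): typed «EPH+UND:STRUCT | UND:MIXED+EPH»; word of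
record «UND:MIXED+EPH» ⇒ AGREE; an A12 fire re-words «EPH(spin-inert …)» (bare head, no rider by the director's rider rule) ⇒
PARTIAL ⇒ LOSS and WRONG FIRE under the amended unit, but NOT a new DISAGREE (the «EPH+UND:STRUCT» alternative is EPH-led, so its
primary is emitted); had the rider «UND:STRUCT» been printed the fire would score AGREE (inert). [folklore] -/
theorem av3sb5_fire :
    let typed : List (List Head) := [[eph, undStruct], [undMixed, eph]]
    score [undMixed, eph] typed = .AGREE ∧ score [eph] typed = .PARTIAL
    ∧ branchOf (score [undMixed, eph] typed) (score [eph] typed) = .LOSS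
    ∧ wrongFireOf (score [undMixed, eph] typed) (score [eph] typed) = true
    ∧ newDisagreeOf (score [undMixed, eph] typed) (score [eph] typed) = false
    ∧ score [eph, undStruct] typed = .AGREE := by
  decide

/-- Pilot leg (ii) kill arithmetic as pre-registered: KILL = at least two of the three AV₃Sb₅ rows fire; each fire is one wrong
fire by `av3sb5_fire`, so the verdict is a function of the fire count alone. [folklore] -/
def leg2Kill (fires : ℕ) : Bool := decide (2 ≤ fires)

/-- 0 or 1 fire ⇒ no kill (leg (iii) runs); 2 or 3 ⇒ «A12 AS WORDED FAILS ITS ADOPTION CLAUSE». [folklore] -/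
theorem leg2Kill_table : leg2Kill 0 = false ∧ leg2Kill 1 = false ∧ leg2Kill 2 = true ∧ leg2Kill 3 = true := by decide

end RouterScore

end Summit.Ventures.CertifiedManyBodySolver.Downfold
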